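import Mathlib
import Summits.Ventures.PercRepro2.Defs
import Summits.Ventures.PercRepro2.Graph
import Summits.Ventures.PercRepro2.Induced
import Summits.Ventures.PercRepro2.VdBKahn
import Summits.Ventures.PercRepro2.ReimerVdBK
import Summits.Ventures.PercRepro2.ReimerVdBKRegions
import Summits.Ventures.PercRepro2.ReimerVdBKLeafGadget

/-!
# The Z-reduction at a leaf: (R-1.2) with a leaf in `X ∩ Y` is the weighted instance at its neighbour
(blind cell PercRepro2, mine-c g45; `conjectures/MINE-C.md` §54.6, the case of g43's «smallest open
instance» §52.6 (c))

A vertex `z ∈ Z = X ∩ Y` is avoided by both worlds.  When `z` is a LEAF with edge `f = {z, u}`, «`z` in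
neither world» is the weight `(0, 0, 0, 1)` on the type of `z`, which the leaf gadget transfers to the weight
`(0, 1, 1, 2)` on the type of `u`: both sides of (R-1.2) for the instance `(A, X ∪ {z}; B, Y ∪ {z})` are twice
the two-world counts of the instance `(A, X; B, Y)` weighted by `(0, 1, 1, 2)(type u)` — the configurations
with `u` in the core are dropped, those with `u` in one world counted once, those with `u` in neither world
twice (`reimerCount_insert_leaf`).  Hence (R-1.2) with the leaf in `Z` is EQUIVALENT to the weighted
inequality at `u` on the instance without `z` (`rvdBK_insert_leaf_iff`).  Iterated over `Z`, this is the
Z-reduction of §54.6: (R-1.2) is the family of Harris pairs weighted by the frontier weights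
`(0, 1, 1, 2^k)`.
-/

namespace Summit.Ventures.PercRepro2

namespace ReimerVdBK

open Classical

variable {V : Type*} {E : Type*} [Fintype E] [DecidableEq E] [Fintype V] [DecidableEq V]

variable (ends : E → Sym2 V) (s : V)

/-- «In Z» `(0,0,0,1)`: the weight of a vertex in neither world. -/
def wInZ : Fin 4 → ℚ | 0 => 0 | 1 => 0 | 2 => 0 | 3 => 1

/-- The single-edge Z-gadget weight `(0,1,1,2)`. -/
def wZGadget : Fin 4 → ℚ | 0 => 0 | 1 => 1 | 2 => 1 | 3 => 2

/-- The transfer of «in Z» `(0,0,0,1)` is `(0,1,1,2)`. -/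
lemma transfer_inZ : transfer wInZ = wZGadget := by
  funext i
  match i with
  | 0 => show (0 : ℚ) + 0 = 0; norm_num
  | 1 => show (0 : ℚ) + 1 = 1; norm_num
  | 2 => show (0 : ℚ) + 1 = 1; norm_num
  | 3 => show 2 * (1 : ℚ) = 2; norm_num

omit [Fintype E] [DecidableEq E] [Fintype V] [DecidableEq V] in
/-- The weight `(0,0,0,1)` of the type of `v` is the indicator of «`v` in neither world». -/
lemma wInZ_vtype (ω : Config E) (v : V) :
    wInZ (vtype ends s ω v) = if v ∈ K₁ ends s ω ∨ v ∈ K₂ ends s ω then 0 else 1 := by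
  unfold vtype
  by_cases h1 : v ∈ K₁ ends s ω <;> by_cases h2 : v ∈ K₂ ends s ω <;> simp [h1, h2, wInZ]

omit [Fintype E] [DecidableEq E] [Fintype V] in
/-- Adding `z` to both avoided sets: membership in the two-world event of `(A, X ∪ {z}; B, Y ∪ {z})` is
membership in that of `(A, X; B, Y)` together with «`z` in neither world». -/
lemma mem_twoWorld_insert_iff (A X B Y : Finset V) (z : V) (ω : Config E) :
    ω ∈ twoWorld ends s A (insert z X) B (insert z Y) ↔
      ω ∈ twoWorld ends s A X B Y ∧ ¬ (z ∈ K₁ ends s ω ∨ z ∈ K₂ ends s ω) := by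
  simp only [twoWorld, connAll, avoidAll, Set.mem_inter_iff, Set.mem_setOf_eq, mem_bar,
    Finset.mem_insert, forall_eq_or_imp, mem_K₁, mem_K₂, not_or]
  tauto

/-- **The count with a vertex added to `Z` is the weighted count with `(0,0,0,1)` at that vertex.** -/
theorem reimerCount_insert_eq_weightedCount (A X B Y : Finset V) (z : V) :
    (reimerCount ends s A (insert z X) B (insert z Y) : ℚ) = weightedCount ends s wInZ z A X B Y := by
  unfold reimerCount count weightedCount
  push_cast
  refine Finset.sum_congr rfl fun ω _ => ?_
  rw [wInZ_vtype, mem_twoWorld_insert_iff]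
  by_cases h : ω ∈ twoWorld ends s A X B Y <;>
    by_cases hz : Conn ends ω s z ∨ Conn ends (compl ω) s z <;>
    simp [h, hz, mem_K₁, mem_K₂]

section Leaf

variable {ends} {s}
variable {ℓ u : V} {f : E} (hf : ends f = s(ℓ, u)) (hleaf : ∀ e, ℓ ∈ ends e → e = f) (hℓu : ℓ ≠ u)

include hf hleaf hℓu

/-- **The Z-reduction at a leaf**: for an unmarked leaf `ℓ` with edge `{ℓ, u}`, twice the two-world count
of the instance with `ℓ` added to `X ∩ Y` is the two-world count of the instance without `ℓ` weighted by
`(0, 1, 1, 2)` on the type of `u`. -/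
theorem reimerCount_insert_leaf {A X B Y : Finset V} (hℓ : ℓ ∉ A ∪ X ∪ B ∪ Y) (hsℓ : s ≠ ℓ) :
    2 * (reimerCount ends s A (insert ℓ X) B (insert ℓ Y) : ℚ) =
      weightedCount ends s wZGadget u A X B Y := by
  rw [reimerCount_insert_eq_weightedCount, leafGadget_twoWorld hf hleaf hℓu wInZ hℓ hsℓ, transfer_inZ]

/-- **(R-1.2) with a leaf in `Z` is the weighted inequality at its neighbour**: for an unmarked leaf `ℓ`,
`RvdBK A (X ∪ {ℓ}) B (Y ∪ {ℓ})` holds iff the two-world counts of `(A, X; B, Y)` and of its right side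
`(A ∪ B, X ∩ Y; ∅, X ∪ Y)`, weighted by `(0, 1, 1, 2)` on the type of `u`, are ordered. -/
theorem rvdBK_insert_leaf_iff {A X B Y : Finset V} (hℓ : ℓ ∉ A ∪ X ∪ B ∪ Y) (hsℓ : s ≠ ℓ) :
    RvdBK ends s A (insert ℓ X) B (insert ℓ Y) ↔
      weightedCount ends s wZGadget u A X B Y ≤
        weightedCount ends s wZGadget u (A ∪ B) (X ∩ Y) ∅ (X ∪ Y) := by
  have hℓ' : ℓ ∉ (A ∪ B) ∪ (X ∩ Y) ∪ ∅ ∪ (X ∪ Y) := by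
    intro h
    apply hℓ
    simp only [Finset.mem_union, Finset.mem_inter, Finset.notMem_empty, or_false] at h ⊢
    tauto
  have h1 := reimerCount_insert_leaf hf hleaf hℓu hℓ hsℓ
  have h2 := reimerCount_insert_leaf hf hleaf hℓu hℓ' hsℓ
  have hX : insert ℓ X ∩ insert ℓ Y = insert ℓ (X ∩ Y) := by
    ext v; simp only [Finset.mem_inter, Finset.mem_insert]; tauto
  have hY : insert ℓ X ∪ insert ℓ Y = insert ℓ (X ∪ Y) := by
    ext v; simp only [Finset.mem_union, Finset.mem_insert]; tauto
  unfold RvdBK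
  rw [hX, hY, ← Nat.cast_le (α := ℚ)]
  constructor
  · intro h; linarith
  · intro h; linarith

end Leaf

end ReimerVdBK

end Summit.Ventures.PercRepro2
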